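import Summits.MatrixMultiplication.MatrixMultiplication.Theorems.AbelianSTPPCensusShapeCertVPBounds

/-!
# Abelian STPP census — soundness of `ShapeCertVP` (part 4c: the search)

Cell mm-stpp, route `AbelianSTPPCensusVP`, crux `ShapeExclusionVP337` (stmt-MatrixMultiplication-19191); seat mm-stpp-theory.
`feasP_complete` (the vM admissibility test accepts every admissible one-member extension of the prefix, after eng-2's
`feasA_complete`), the search induction (`stepV_sound`, `loopV_sound`, `dfsV_sound`: a `true` verdict above a prefix
means no admissible family above it inside the remaining candidate pool has integer gain above `10⁶·M`), and
**`checkV_sound`**: if `checkV M = true` (`M ≤ 337`) then no family in the universe of order `M` satisfying `AdmM` and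
`AdmG` has integer gain above `10⁶·M`.  The bridge to the route's `SieveAdmissibleVP` / `Beats (5/2)` is
`…ShapeCertVPFinal`.
-/

set_option linter.dupNamespace false -- `MatrixMultiplication.MatrixMultiplication` (summit = problem, D-0017)
set_option autoImplicit false

namespace Summit.MatrixMultiplication.MatrixMultiplication.Theorems.ShapeCertVP

open ShapeCert Multiset

section feas
/-! ### The admissibility test accepts every admissible extension (after eng-2's `feasA_complete`) -/

variable {M : ℕ}

/-- **completeness of the admissibility test** -/
theorem feasP_complete {t : Sh} {fam : List Sh} {G : Multiset (ℕ × ℕ × ℕ)} (h : AboveV M G (t :: fam))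
    (hF : famT (t :: fam) = G) :
    feasP M ((aggOf M fam).push t) t (!fam.isEmpty) (aggOf M fam).mxV (aggOf M fam).mxP (t :: fam) = true := by
  subst hF
  have hz : famT (t :: fam) - famT (t :: fam) = 0 := tsub_self _
  have u1 := h.tail_wa; have u2 := h.tail_wb; have u3 := h.tail_wc
  have p1 := h.tail_pab; have p2 := h.tail_pbc; have p3 := h.tail_pca
  rw [hz] at u1 u2 u3 p1 p2 p3
  simp only [Multiset.map_zero, Multiset.sum_zero, zero_add] at u1 u2 u3 p1 p2 p3
  obtain ⟨⟨q1, q2, q3⟩, -, h9, h14, hT⟩ := h.adm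
  rw [← sab_eqV h.wf] at q1; rw [← sbc_eqV h.wf] at q2; rw [← sca_eqV h.wf] at q3
  have htU : InUniv M t.tr := h.univ _ (tr_mem_famT (by simp))
  have h9a : ∀ l ∈ fam, t.mpp + l.V ≤ M ∧ l.mpp + t.V ≤ M := by
    intro l hl
    have hlF : l.tr ∈ famT (t :: fam) := tr_mem_famT (List.mem_cons_of_mem _ hl)
    have htF : t.tr ∈ famT (t :: fam) := tr_mem_famT (by simp)
    have e1 : famT (t :: fam) = t.tr ::ₘ famT fam := rfl
    have m1 : l.tr ∈ (famT (t :: fam)).erase t.tr := by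
      rw [e1, Multiset.erase_cons_head]; exact tr_mem_famT hl
    have m2 : t.tr ∈ (famT (t :: fam)).erase l.tr := by
      by_cases he : l.tr = t.tr
      · rw [he, e1, Multiset.erase_cons_head, ← he]; exact tr_mem_famT hl
      · rw [e1, Multiset.erase_cons_tail _ (Ne.symm he)] ; exact Multiset.mem_cons_self _ _
    have a := h9 t.tr htF l.tr m1
    have b := h9 l.tr hlF t.tr m2
    have wt := h.wf t (by simp); have wl := h.wf l (List.mem_cons_of_mem _ hl)
    have em := congrArg Sh.mpp wt; have ev := congrArg Sh.V wt
    have em' := congrArg Sh.mpp wl; have ev' := congrArg Sh.V wl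
    rw [shV_mpp] at em em'; rw [shV_V] at ev ev'
    constructor <;> omega
  have hT2 : ∀ l ∈ t :: fam, t2ok M (sab (t :: fam)) (sbc (t :: fam)) (sca (t :: fam)) l = true := by
    intro l hl
    have hlF : l.tr ∈ famT (t :: fam) := tr_mem_famT hl
    obtain ⟨x1, x2, x3⟩ := hT l.tr hlF
    have s1 := h.erase_split hl pab; have s2 := h.erase_split hl pbc; have s3 := h.erase_split hl pca
    rw [hz] at s1 s2 s3
    simp only [Multiset.map_zero, Multiset.sum_zero, add_zero] at s1 s2 s3
    rw [← sab_eqV h.wf] at s1; rw [← sbc_eqV h.wf] at s2; rw [← sca_eqV h.wf] at s3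
    have hUl := h.univ _ hlF
    have v1 := hUl.pab_le_vol; have v2 := hUl.pbc_le_vol; have v3 := hUl.pca_le_vol
    have wl := h.wf l hl
    have eV := congrArg Sh.V wl; have eab := congrArg Sh.ab wl; have ebc := congrArg Sh.bc wl
    have eca := congrArg Sh.ca wl; have ea := congrArg Sh.a wl; have eb := congrArg Sh.b wl
    have ec := congrArg Sh.c wl
    rw [shV_V] at eV; rw [shV_ab] at eab; rw [shV_bc] at ebc; rw [shV_ca] at eca
    rw [shV_a] at ea; rw [shV_b] at eb; rw [shV_c] at ec
    apply t2ok_of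
    · intro ha hb; rw [eV, ea, ec]; exact x1 (by omega) (by omega)
    · intro ha hb; rw [eV, eb, ea]; exact x2 (by omega) (by omega)
    · intro ha hb; rw [eV, ec, eb]; exact x3 (by omega) (by omega)
  have hmpp := htU.mpp_le
  have hVt : t.V ≤ M := by
    have := htU.vol_le; have ev := congrArg Sh.V (h.wf t (by simp)); rw [shV_V] at ev; omega
  have emt := congrArg Sh.mpp (h.wf t (by simp)); rw [shV_mpp] at emt
  rw [← aggOf_cons]
  unfold feasP
  simp only [aggOf, Bool.and_eq_true, decide_eq_true_eq, Bool.or_eq_true, List.all_eq_true, Bool.not_not]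
  refine ⟨⟨⟨⟨⟨⟨⟨⟨⟨⟨u1, u2⟩, u3⟩, q1⟩, q2⟩, q3⟩, by omega⟩, by omega⟩, by omega⟩, ?_⟩, hT2⟩
  by_cases he : fam = []
  · left; simp [he]
  · right
    constructor
    · have : mxV fam ≤ M - t.mpp := mxV_le fun l hl => by have := (h9a l hl).1; omega
      omega
    · have : mxP fam ≤ M - t.V := mxP_le fun l hl => by have := (h9a l hl).2; omega
      omega

end feas

section search
/-! ### The search is sound -/

variable {M : ℕ}

/-- the tail of a good pool is good -/
theorem PoolOK.tail {R : List Sh} {t : Sh} (h : PoolOK M (t :: R)) : PoolOK M R :=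
  ⟨fun s hs => h.wf s (List.mem_cons_of_mem _ hs), fun s hs => h.univ s (List.mem_cons_of_mem _ hs),
    (List.pairwise_cons.mp h.sorted).2⟩

/-- **Soundness of one candidate step.**  If `stepV` accepts candidate `t` (a tail member of the family) then the
family does not beat — given the induction hypothesis for the recursive search. -/
theorem stepV_sound {rec : List Sh → List Sh → Bool} {t : Sh} {fam rest : List Sh}
    (IH : ∀ fam' R', WfV M fam' → PoolOK M R' → (fam' ≠ [] → ∀ s ∈ R', s.lev ≤ headLev fam') →
      rec fam' R' = true → GoalV M fam' R')
    (hwf : WfV M fam) (hP : PoolOK M (t :: rest))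
    (hstep : stepV M rec t (aggOf M fam) fam ((aggOf M fam).gs * K) ((aggOf M fam).q0 M)
      (selOf ((aggOf M fam).kOf M)) (M * D * K) rest = true)
    {G : Multiset (ℕ × ℕ × ℕ)} (hG : AboveV M G fam) (hbeat : M * D < gsumV G)
    (hpool : ∀ x ∈ G - famT fam, levT x ≤ 27 ∨ shV M x ∈ t :: rest) (hx : t.tr ∈ G - famT fam) : False := by
  have hwt : t = shV M t.tr := hP.wf t (by simp)
  -- every tail member has level ≤ 27 or ≤ t.lev
  have hL : ∀ x ∈ G - famT fam, levT x ≤ 27 ∨ levT x ≤ t.lev := by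
    intro x hx'
    rcases hpool x hx' with h | h
    · exact Or.inl h
    · right
      rcases List.mem_cons.mp h with h | h
      · rw [← shV_lev M x, h]
      · have := List.rel_of_pairwise_cons hP.sorted h
        rw [← shV_lev M x]; exact this
  unfold stepV at hstep
  rw [aggOf_gs] at hstep
  by_cases hpre : gs fam * K + t.g * K + selOf ((aggOf M fam).kOf M) (tabR t.lev) *
      min ((aggOf M fam).q0 M) ((3 * M + (t.a + t.b + t.c)) / 2 - uuA (aggOf M fam) - (t.ab + t.bc + t.ca)) ≤
      M * D * K
  · exact hG.not_beat_of_first hx hwt hL hpre hbeat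
  rw [if_neg hpre, Agg.force_eq] at hstep
  -- the extended prefix
  have hwf1 : WfV M (t :: fam) := by
    intro s hs; rcases List.mem_cons.mp hs with rfl | hs
    · exact hwt
    · exact hwf s hs
  have hle1 : famT (t :: fam) ≤ G := cons_le_of_mem_sub hG.le hx
  have hG1 : AboveV M G (t :: fam) := ⟨hG.hM, hG.univ, hG.adm, hG.admG, hwf1, hle1⟩
  have hpool1 : ∀ x ∈ G - famT (t :: fam), levT x ≤ 27 ∨ shV M x ∈ t :: rest :=
    fun x hx' => hpool x (Multiset.mem_of_le (sub_cons_le _ _ _) hx')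
  have hL1 : ∀ x ∈ G - famT (t :: fam), levT x ≤ 27 ∨ levT x ≤ t.lev :=
    fun x hx' => hL x (Multiset.mem_of_le (sub_cons_le _ _ _) hx')
  by_cases hpr : ((aggOf M fam).push t).prune M (tabR t.lev) = true
  · rw [← aggOf_cons] at hpr
    have hp := prune_sound hpr
    rw [aggOf_gs] at hp
    exact hG1.not_beat_of_R hL1 hp hbeat
  rw [if_neg hpr] at hstep
  -- admissibility of the extended prefix is recognised
  have hF : AboveV M (famT (t :: fam)) (t :: fam) :=
    ⟨hG.hM, fun x hx' => hG.univ x (Multiset.mem_of_le hle1 hx'), hG.adm.mono hle1, hG.admG.mono hle1, hwf1, le_rfl⟩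
  rw [feasP_complete hF rfl, if_pos rfl] at hstep
  by_cases hk : killV M ((aggOf M fam).push t) (t :: fam) = true
  · rw [← aggOf_cons] at hk
    exact not_admG_of_killV hwf1 hk (hG.admG.mono hle1)
  rw [if_neg hk] at hstep
  -- recursion
  exact IH (t :: fam) (t :: rest) hwf1 hP (fun _ s hs => by
    rcases List.mem_cons.mp hs with rfl | hs
    · exact le_rfl
    · exact List.rel_of_pairwise_cons hP.sorted hs) hstep G hG1 hbeat hpool1

/-- **Soundness of one level of the walk** (induction on the candidate list) -/
theorem loopV_sound {rec : List Sh → List Sh → Bool} {fam : List Sh}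
    (IH : ∀ fam' R', WfV M fam' → PoolOK M R' → (fam' ≠ [] → ∀ s ∈ R', s.lev ≤ headLev fam') →
      rec fam' R' = true → GoalV M fam' R')
    (hwf : WfV M fam) (hM : M ≤ 337) (hnb : ¬ M * D < (aggOf M fam).gs)
    {lb1 : ℕ} (hlb : lb1 ≠ 0 → 27 ≤ lb1 - 1 ∧
      ((aggOf M fam).gs * K + (aggOf M fam).bnd M (tabR (lb1 - 1)) ≤ M * D * K ∨
       ∃ i b, (budsOf M (aggOf M fam) fam).get i = some b ∧
         (aggOf M fam).gs * K + b * (tabG (lb1 - 1)).get i ≤ M * D * K))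
    {cl : Bool} (hcl : cl = true → fam = [] ∨ (aggOf M fam).gs * K + (aggOf M fam).bnd M (tabR 27) ≤ M * D * K ∨
       ∃ i b, (budsOf M (aggOf M fam) fam).get i = some b ∧ (aggOf M fam).gs * K + b * (tabG 27).get i ≤ M * D * K) :
    ∀ R : List Sh, PoolOK M R →
      loopV M rec fam (aggOf M fam) ((aggOf M fam).ra M) ((aggOf M fam).rb M) ((aggOf M fam).rc M)
        ((aggOf M fam).vl M) ((aggOf M fam).gs * K) ((aggOf M fam).q0 M) (selOf ((aggOf M fam).kOf M)) (M * D * K)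
        lb1 cl R = true → GoalV M fam R
  | [], _, hloop => by
    intro G hG hbeat hpool
    rw [loopV] at hloop
    have hlow : ∀ x ∈ G - famT fam, levT x ≤ 27 := fun x hx => by
      rcases hpool x hx with h | h
      · exact h
      · simp at h
    rcases hcl hloop with h | h | ⟨i, b, hb, hle⟩
    · subst h
      have : G - famT [] = G := by simp [famT]
      rw [this] at hlow
      exact gsum_le_of_low hM hG.univ hG.adm hlow hbeat
    · exact hG.not_beat_of_R (L := 27) (fun x hx => Or.inl (hlow x hx)) (by simpa only [aggOf_gs] using h) hbeat
    · exact hG.not_beat_of_G hb (L := 27) (fun x hx => Or.inl (hlow x hx)) (by simpa only [aggOf_gs] using hle) hbeat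
  | t :: R', hP, hloop => by
    intro G hG hbeat hpool
    rw [loopV] at hloop
    -- break: every tail member has level ≤ t.lev ≤ lb1 - 1
    by_cases hbr : t.lev < lb1
    · obtain ⟨h27, hb⟩ := hlb (by omega)
      have hL : ∀ x ∈ G - famT fam, levT x ≤ 27 ∨ levT x ≤ lb1 - 1 := by
        intro x hx
        rcases hpool x hx with h | h
        · exact Or.inl h
        · right
          have : (shV M x).lev ≤ t.lev := by
            rcases List.mem_cons.mp h with h | h
            · rw [h]
            · exact List.rel_of_pairwise_cons hP.sorted h
          rw [shV_lev] at this; omega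
      rcases hb with hb | ⟨i, b, hbi, hle⟩
      · exact hG.not_beat_of_R hL (by simpa only [aggOf_gs] using hb) hbeat
      · exact hG.not_beat_of_G hbi hL (by simpa only [aggOf_gs] using hle) hbeat
    rw [if_neg hbr] at hloop
    have hpool' : t.tr ∉ G - famT fam → ∀ x ∈ G - famT fam, levT x ≤ 27 ∨ shV M x ∈ R' := by
      intro ht x hx
      rcases hpool x hx with h | h
      · exact Or.inl h
      · rcases List.mem_cons.mp h with he | he
        · exfalso; apply ht; rw [← he, shV_tr]; exact hx
        · exact Or.inr he
    by_cases hch : (aggOf M fam).ra M < t.wA ∨ (aggOf M fam).rb M < t.wB ∨ (aggOf M fam).rc M < t.wC ∨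
        (aggOf M fam).vl M < t.V
    · -- cheap reject: `t` cannot be a tail member
      rw [if_pos hch] at hloop
      refine loopV_sound IH hwf hM hnb hlb hcl R' hP.tail hloop G hG hbeat (hpool' fun hx => ?_)
      have hU := hG.univ _ (mem_G_of_tail hx)
      have w1 := Multiset.le_sum_of_mem (Multiset.mem_map_of_mem wa hx)
      have w2 := Multiset.le_sum_of_mem (Multiset.mem_map_of_mem wb hx)
      have w3 := Multiset.le_sum_of_mem (Multiset.mem_map_of_mem wc hx)
      have t1 := hG.tail_wa; have t2 := hG.tail_wb; have t3 := hG.tail_wc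
      obtain ⟨v1, v2, v3, v4⟩ := hG.tail_vol hx
      have wt := hP.wf t (by simp)
      have ea := congrArg Sh.wA wt; have eb := congrArg Sh.wB wt; have ec := congrArg Sh.wC wt
      have ev := congrArg Sh.V wt
      rw [shV_wA] at ea; rw [shV_wB] at eb; rw [shV_wC] at ec; rw [shV_V] at ev
      unfold Agg.ra Agg.rb Agg.rc Agg.vl Agg.mc aggOf at hch; simp only at hch
      have hm : max (max (sab fam) (max (sbc fam) (sca fam))) (mxP fam) ≤ M - vol t.tr :=
        max_le (max_le (by omega) (max_le (by omega) (by omega))) (by omega)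
      omega
    rw [if_neg hch, Bool.and_eq_true] at hloop
    obtain ⟨hstep, hrest⟩ := hloop
    by_cases hx : t.tr ∈ G - famT fam
    · exact stepV_sound IH hwf hP hstep hG hbeat hpool hx
    · exact loopV_sound IH hwf hM hnb hlb hcl R' hP.tail hrest G hG hbeat (hpool' hx)

/-- **Soundness of the search** (induction on the fuel) -/
theorem dfsV_sound (hM : M ≤ 337) : ∀ (n : ℕ) (fam R : List Sh), WfV M fam → PoolOK M R →
    (fam ≠ [] → ∀ s ∈ R, s.lev ≤ headLev fam) → dfsV M n fam R = true → GoalV M fam R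
  | 0, fam, R, _, _, _, h => by simp [dfsV] at h
  | n + 1, fam, R, hwf, hP, hhead, h => by
    simp only [dfsV, Agg.force_eq, seqN_eq] at h
    intro G hG hbeat hpool
    by_cases hb : M * D < (aggOf M fam).gs
    · rw [if_pos hb] at h; exact Bool.false_ne_true h
    rw [if_neg hb] at h
    by_cases hd : (aggOf M fam).dead M = true
    · have h0 := hG.tail_eq_zero_of_dead hd
      rw [hG.gsum_split, h0] at hbeat; simp [gsumV] at hbeat; rw [aggOf_gs] at hb; omega
    rw [if_neg hd] at h
    -- levels of the tail are bounded by the node's own level (or 27)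
    have hL : fam ≠ [] → ∀ x ∈ G - famT fam, levT x ≤ 27 ∨ levT x ≤ headLev fam := by
      intro hf x hx
      rcases hpool x hx with h' | h'
      · exact Or.inl h'
      · right; rw [← shV_lev M x]; exact hhead hf _ h'
    by_cases hte : (budsOf M (aggOf M fam) fam).tailEmpty = true
    · rw [if_pos hte, decide_eq_true_eq] at h
      obtain ⟨i, b, hbi, hsmall⟩ := tailEmpty_spec hte
      exact hG.not_beat_of_empty hbi hsmall h hbeat
    rw [if_neg hte] at h
    set S := gnode (headLev fam) (budsOf M (aggOf M fam) fam) with hS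
    by_cases hg : (S.ok && decide ((aggOf M fam).gs * K + S.bud * (tabG (headLev fam)).get S.idx ≤ M * D * K)) =
        true
    · rw [Bool.and_eq_true, decide_eq_true_eq] at hg
      by_cases hf : fam = []
      · subst hf
        rw [budsOf_nil] at hS
        have : S.ok = false := by rw [hS]; rfl
        rw [this] at hg; exact Bool.false_ne_true hg.1
      · have hsel := gnode_spec (headLev fam) (budsOf M (aggOf M fam) fam) hg.1
        exact hG.not_beat_of_G hsel (hL hf) hg.2 hbeat
    rw [if_neg hg] at h
    generalize hlb : breakLev ((aggOf M fam).gs * K) ((aggOf M fam).q0 M) (selOf ((aggOf M fam).kOf M)) (M * D * K)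
      S.ok S.bud S.idx = lb1 at h
    generalize hcl : ((fam.isEmpty || decide ((aggOf M fam).gs * K + selOf ((aggOf M fam).kOf M) (tabR 27) *
      (aggOf M fam).q0 M ≤ M * D * K)) || (budsOf M (aggOf M fam) fam).clAny ((aggOf M fam).gs * K) (M * D * K) 27)
      = cl at h
    refine loopV_sound (fun fam' R' => dfsV_sound hM n fam' R') hwf hM hb ?_ ?_ R hP h G hG hbeat hpool
    · -- the break level
      intro h0
      obtain ⟨h27, hc⟩ := breakLev_spec hlb h0
      refine ⟨h27, ?_⟩
      rcases hc with hc | ⟨hok, hc⟩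
      · exact Or.inl (bnd_le_of_test hc)
      · exact Or.inr ⟨S.idx, S.bud, gnode_spec _ _ hok, hc⟩
    · -- the closure value
      intro hc
      rw [← hcl] at hc
      simp only [Bool.or_eq_true, decide_eq_true_eq] at hc
      rcases hc with (hc | hc) | hc
      · exact Or.inl (List.isEmpty_iff.mp hc)
      · exact Or.inr (Or.inl (bnd_le_of_test hc))
      · obtain ⟨i, b, hbi, hle⟩ := clAny_spec hc
        exact Or.inr (Or.inr ⟨i, b, hbi, hle⟩)

/-- **Soundness of the checker.** If `checkV M` succeeds (`M ≤ 337`), no shape multiset inside the universe that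
satisfies the vM system and rule U11-G (credit form) has integer gain above `10⁶·M`. -/
theorem checkV_sound {M : ℕ} (h : checkV M = true) (hM : M ≤ 337) (G : Multiset (ℕ × ℕ × ℕ))
    (hU : ∀ x ∈ G, InUniv M x) (hA : AdmM M G) (hG : AdmG M G) : ¬ M * D < gsumV G := by
  intro hbeat
  have hP : PoolOK M (candV M) := ⟨candV_wf M, candV_inUniv M, candV_sorted M⟩
  refine dfsV_sound hM (M + 2) [] (candV M) (fun _ h => by simp at h) hP (fun h => absurd rfl h) h G
    ⟨hM, hU, hA, hG, fun _ h => by simp at h, by simp [famT]⟩ hbeat ?_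
  intro x hx
  have hxG : x ∈ G := Multiset.mem_of_le (Multiset.sub_le_self _ _) hx
  rcases Nat.lt_or_ge (levT x) 28 with hl | hl
  · exact Or.inl (by omega)
  · exact Or.inr (shV_mem_candV hM (hU x hxG) hl)

end search

end Summit.MatrixMultiplication.MatrixMultiplication.Theorems.ShapeCertVP
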